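import Mathlib.ModelTheory.Definability
import HarnessLib

/-!
# Definable closure

Topic `Literature/ModelTheory/ExponentialFields`.  The **definable closure** `dcl(A)` of a set
of parameters `A` in a first-order structure `M`: the set of elements `b` such that `{b}` is
definable with parameters from `A` (Marker, *Model Theory: An Introduction* (2002), Exercise
1.4.10: "`b ∈ M` is definable over `A` if … In other words, `{b}` is `A`-definable. … Let
`dcl(A) = {x ∈ M : x is definable from A}`"; den Besten 2016, Def. 7.1.3: "the closure of `A`
under the `A`-definable functions", the same set by Marker's Exercise 1.4.10 (a)).  Mathlib
(this pin) has `Set.Definable` with a parameter set but no definable closure; this file defines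
it on top of `Set.Definable` and proves the closure-operator properties that do not depend on
the theory:

* `definableClosure L A` (`= dcl(A)`), `mem_definableClosure_iff`;
* extensive (`subset_definableClosure`), monotone (`definableClosure_mono`), of finite character
  (`exists_finite_mem_definableClosure`);
* **elimination of definable parameters** (`Set.Definable.of_insert_of_definable_singleton`,
  `Set.Definable.of_subset_definableClosure`): a set definable over parameters that are
  themselves definable over `A` is definable over `A` (substitute the defining formulas and
  quantify the parameters away) — whence idempotence `definableClosure_definableClosure`
  (Marker, Exercise 1.4.10 (c); den Besten, Lemma 7.1.6 (i)–(iii));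
* images: `apply_mem_definableClosure` (a function with `A`-definable graph maps `dcl(A)` into
  `dcl(A)`).

The exchange property (so that `dcl` is a pregeometry) holds in o-minimal structures
(Pillay–Steinhorn 1986, §4; den Besten, Lemma 7.1.6 (iv)) and is NOT in this file.  Nothing
here is a named fact.

## References

* [Marker2002] D. Marker, *Model Theory: An Introduction*, Springer GTM 217 (2002), §1.4,
  §4.1.
* [DenBesten2016] M. den Besten, *Wilkie's Theorem and the Uniform Real Schanuel Conjecture*,
  MSc thesis, Utrecht 2016, Def. 7.1.3, Lemma 7.1.6.
-/

open Set FirstOrder FirstOrder.Language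

namespace Literature.ModelTheory.ExponentialFields

universe u v w

variable (L : Language.{u, v}) {M : Type w} [L.Structure M]

/-- The **definable closure** `dcl(A)` of a parameter set `A ⊆ M`: the elements `b ∈ M` such
that the singleton `{b}` is definable (in Mathlib's sense `Set.Definable₁`) with parameters
from `A` (Marker 2002, Exercise 1.4.10; den Besten 2016, Def. 7.1.3).
[cite: Marker2002, Exercise 1.4.10] -/
def definableClosure (A : Set M) : Set M :=
  {b : M | A.Definable₁ L ({b} : Set M)}

variable {L}

/-- Unfolding: `b ∈ dcl(A)` iff `{b}` is `A`-definable. [cite: Marker2002, Exercise 1.4.10] -/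
theorem mem_definableClosure_iff {A : Set M} {b : M} :
    b ∈ definableClosure L A ↔ A.Definable₁ L ({b} : Set M) :=
  Iff.rfl

/-- `dcl` is extensive: `A ⊆ dcl(A)` (den Besten 2016, Lemma 7.1.6 (i)). [cite: DenBesten2016, Lemma 7.1.6 (i)] -/
theorem subset_definableClosure (A : Set M) : A ⊆ definableClosure L A :=
  fun _ ha => Definable.singleton_of_mem L ha

/-- `dcl` is monotone (den Besten 2016, Lemma 7.1.6 (i)). [cite: DenBesten2016, Lemma 7.1.6 (i)] -/
theorem definableClosure_mono {A B : Set M} (h : A ⊆ B) :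
    definableClosure L A ⊆ definableClosure L B :=
  fun _ hb => Definable.mono hb h

/-- `dcl` has finite character: `b ∈ dcl(A)` is witnessed by a finite subset of `A`
(den Besten 2016, Lemma 7.1.6 (iii); Mathlib's `Set.definable_iff_finitely_definable`).
[cite: DenBesten2016, Lemma 7.1.6 (iii)] -/
theorem exists_finite_mem_definableClosure {A : Set M} {b : M} (hb : b ∈ definableClosure L A) :
    ∃ A₀ ⊆ A, A₀.Finite ∧ b ∈ definableClosure L A₀ := by
  obtain ⟨A₀, hA₀, h⟩ := Set.definable_iff_finitely_definable.1 hb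
  exact ⟨A₀, hA₀, A₀.finite_toSet, h⟩

/-! ### Elimination of definable parameters -/

/-- **One definable parameter can be eliminated**: if `s` is definable over `insert b A` and
the singleton `{b}` is definable over `A`, then `s` is definable over `A` — replace the
parameter `b` by a new variable `y`, conjoin the `A`-formula defining `y = b`, and quantify `y`
existentially (the argument of Marker 2002, Exercise 1.4.10 (c); den Besten 2016, proof of
Lemma 7.1.6 (ii)).  Stated in Mathlib's namespace `Set.Definable` as a deliberate dot-notation
extension. [cite: Marker2002, Exercise 1.4.10 (c)] -/
theorem _root_.Set.Definable.of_insert_of_definable_singleton {α : Type*} {A : Set M} {b : M}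
    {s : Set (α → M)} (hs : (insert b A).Definable L s) (hb : A.Definable₁ L ({b} : Set M)) :
    A.Definable L s := by
  classical
  rw [Set.definable_iff_exists_formula_sum] at hs ⊢
  obtain ⟨φ, rfl⟩ := hs
  have hb' := Set.definable_iff_exists_formula_sum.1 hb
  obtain ⟨ψ, hψ⟩ := hb'
  -- relabelling: parameters from `A` stay, the parameter `b` becomes the bound variable
  let g : ↥(insert b A) ⊕ α → (A ⊕ α) ⊕ Fin 1 :=
    Sum.elim (fun p => if h : (p : M) ∈ A then Sum.inl (Sum.inl ⟨p, h⟩) else Sum.inr 0)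
      (fun a => Sum.inl (Sum.inr a))
  let g' : A ⊕ Fin 1 → (A ⊕ α) ⊕ Fin 1 := Sum.elim (fun a => Sum.inl (Sum.inl a)) Sum.inr
  refine ⟨(ψ.relabel g' ⊓ φ.relabel g).iExs (Fin 1), ?_⟩
  ext v
  simp only [mem_setOf_eq, Formula.realize_iExs, Formula.realize_inf, Formula.realize_relabel]
  -- the value of the `ψ`-conjunct: the bound variable equals `b`
  have hψu : ∀ u : Fin 1 → M,
      ψ.Realize (Sum.elim (Sum.elim (fun a : A => (a : M)) v) u ∘ g') ↔ u 0 = b := by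
    intro u
    have hcomp : (Sum.elim (Sum.elim (fun a : A => (a : M)) v) u ∘ g') =
        Sum.elim (fun a : A => (a : M)) u := by
      funext p; cases p <;> rfl
    rw [hcomp]
    have := Set.ext_iff.1 hψ u
    simp only [mem_setOf_eq, mem_singleton_iff] at this
    exact this.symm
  -- the value of the `φ`-conjunct when the bound variable equals `b`
  have hφu : ∀ u : Fin 1 → M, u 0 = b →
      (φ.Realize (Sum.elim (Sum.elim (fun a : A => (a : M)) v) u ∘ g) ↔
        φ.Realize (Sum.elim (fun p : ↥(insert b A) => (p : M)) v)) := by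
    intro u hu
    have hcomp : (Sum.elim (Sum.elim (fun a : A => (a : M)) v) u ∘ g) =
        Sum.elim (fun p : ↥(insert b A) => (p : M)) v := by
      funext p
      rcases p with p | a
      · show Sum.elim (Sum.elim (fun a : A => (a : M)) v) u
          (if h : (p : M) ∈ A then Sum.inl (Sum.inl ⟨p, h⟩) else Sum.inr 0) = (p : M)
        by_cases h : (p : M) ∈ A
        · rw [dif_pos h]; rfl
        · rw [dif_neg h]
          have hp : (p : M) = b := (mem_insert_iff.1 p.2).resolve_right h
          show u 0 = (p : M)
          rw [hp]; exact hu
      · rfl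
    rw [hcomp]
  constructor
  · intro hv
    exact ⟨fun _ => b, (hψu _).2 rfl, (hφu _ rfl).2 hv⟩
  · rintro ⟨u, hu, hφ⟩
    exact (hφu u ((hψu u).1 hu)).1 hφ

/-- **Definable parameters can be eliminated**: a set definable over parameters `B ⊆ dcl(A)`
is definable over `A` (Marker 2002, Exercise 1.4.10 (c); den Besten 2016, Lemma 7.1.6 (ii)).
Dot-notation extension of Mathlib's `Set.Definable`. [cite: Marker2002, Exercise 1.4.10 (c)] -/
theorem _root_.Set.Definable.of_subset_definableClosure {α : Type*} {A B : Set M}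
    {s : Set (α → M)} (hs : B.Definable L s) (hB : B ⊆ definableClosure L A) :
    A.Definable L s := by
  classical
  obtain ⟨B₀, hB₀B, hs₀⟩ := Set.definable_iff_finitely_definable.1 hs
  -- induction on the finite set of parameters actually used
  have key : ∀ T : Finset M, (↑T ⊆ definableClosure L A) → (A ∪ ↑T).Definable L s →
      A.Definable L s := by
    intro T
    induction T using Finset.induction_on with
    | empty => intro _ h; simpa using h
    | @insert b T hbT ih =>
      intro hT h
      have hb : b ∈ definableClosure L A := hT (Finset.mem_coe.2 (Finset.mem_insert_self b T))
      have hT' : ↑T ⊆ definableClosure L A := fun z hz =>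
        hT (Finset.mem_coe.2 (Finset.mem_insert_of_mem (Finset.mem_coe.1 hz)))
      refine ih hT' (Set.Definable.of_insert_of_definable_singleton (b := b) ?_ ?_)
      · have heq : insert b (A ∪ ↑T) = A ∪ ↑(insert b T) := by
          rw [Finset.coe_insert, Set.union_insert]
        rw [heq]; exact h
      · exact Definable.mono hb subset_union_left
  exact key B₀ (hB₀B.trans hB) (hs₀.mono subset_union_right)

/-- A set definable over `dcl(A)` is definable over `A` (and conversely, by monotonicity)
(Marker 2002, Exercise 1.4.10 (c)). [cite: Marker2002, Exercise 1.4.10 (c)] -/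
theorem definable_definableClosure_iff {α : Type*} {A : Set M} {s : Set (α → M)} :
    (definableClosure L A).Definable L s ↔ A.Definable L s :=
  ⟨fun h => h.of_subset_definableClosure le_rfl, fun h => h.mono (subset_definableClosure A)⟩

/-- `dcl` is idempotent: `dcl(dcl(A)) = dcl(A)` (Marker 2002, Exercise 1.4.10 (c); den Besten
2016, Lemma 7.1.6 (ii)). [cite: Marker2002, Exercise 1.4.10 (c)] -/
theorem definableClosure_definableClosure (A : Set M) :
    definableClosure L (definableClosure L A) = definableClosure L A :=
  Set.ext fun _ => definable_definableClosure_iff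

/-- `dcl(A)` is definably closed: if `B ⊆ dcl(A)` then `dcl(B) ⊆ dcl(A)`. [cite: DenBesten2016, Lemma 7.1.6] -/
theorem definableClosure_subset_of_subset {A B : Set M} (h : B ⊆ definableClosure L A) :
    definableClosure L B ⊆ definableClosure L A := fun _ hb =>
  Set.Definable.of_subset_definableClosure hb h

/-! ### Definable functions preserve the definable closure -/

/-- A convenient criterion for membership in `dcl(A)`: if an `A`-definable subset `s` of the
line equals the singleton `{b}`, then `b ∈ dcl(A)`. [folklore] -/
theorem mem_definableClosure_of_eq_singleton {A : Set M} {s : Set M} {b : M}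
    (hs : A.Definable₁ L s) (hsb : s = {b}) : b ∈ definableClosure L A := by
  rw [mem_definableClosure_iff, ← hsb]; exact hs

/-- **Definable functions map `dcl(A)` into `dcl(A)`** (den Besten 2016, proof of Lemma 7.1.6
(ii): "`f(g₁(x̄), …, gₙ(x̄))` is a definable function"): if the graph of `f : M → M` is
`A`-definable and `a ∈ dcl(A)`, then `f a ∈ dcl(A)`. [cite: DenBesten2016, Lemma 7.1.6 (ii)] -/
theorem apply_mem_definableClosure {A : Set M} {f : M → M}
    (hf : A.Definable L {v : Fin 2 → M | v 1 = f (v 0)}) {a : M}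
    (ha : a ∈ definableClosure L A) : f a ∈ definableClosure L A := by
  -- `{f a}` is definable over `insert a A`, hence over `A`
  have h : (insert a A).Definable₁ L ({f a} : Set M) := by
    -- `{y | y = f a}` is the preimage of the graph under `y ↦ (a, y)`
    have hg : (insert a A).Definable L {v : Fin 2 → M | v 1 = f (v 0)} :=
      hf.mono (subset_insert a A)
    have hc : (insert a A).Definable L {v : Fin 2 → M | v 0 = a} := by
      have h1 : (insert a A).DefinableFun L (fun v : Fin 2 → M => v 0) := DefinableFun.proj L
      exact h1.setOf_eq_const (mem_insert a A)
    have h2 := (hg.inter hc).image_comp (fun _ : Fin 1 => (1 : Fin 2))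
    have h3 : {x : Fin 1 → M | x 0 ∈ ({f a} : Set M)} =
        (fun g : Fin 2 → M => g ∘ fun _ : Fin 1 => (1 : Fin 2)) ''
          ({v : Fin 2 → M | v 1 = f (v 0)} ∩ {v | v 0 = a}) := by
      ext w
      simp only [mem_setOf_eq, mem_singleton_iff, mem_image, mem_inter_iff]
      constructor
      · intro hw
        refine ⟨![a, f a], ⟨rfl, rfl⟩, ?_⟩
        funext i
        rw [Subsingleton.elim i 0]
        simpa using hw.symm
      · rintro ⟨v, ⟨hv1, hv0⟩, rfl⟩
        simp [hv1, hv0]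
    show (insert a A).Definable L {x : Fin 1 → M | x 0 ∈ ({f a} : Set M)}
    rw [h3]
    exact h2
  exact Set.Definable.of_insert_of_definable_singleton h ha

end Literature.ModelTheory.ExponentialFields
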